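import Summits.Ventures.Crystal3D.Theorems.StickyWulffConstantStackingLiminfMollifierSmooth
import Summits.Ventures.Crystal3D.Theorems.StickyWulffConstantStackingLiminfRungBumpMass
import Summits.Ventures.Crystal3D.Theorems.StickyWulffConstantStackingLiminfRungEtaMass
import Mathlib.MeasureTheory.Integral.Prod
import HarnessLib

/-!
# Rung R7 of line `LayerChain` v4 (crux `StackingLiminf`, stmt-Ventures-19145): the doubly mollified
# density has total mass exactly `N/√2`

Cell `crystal3d-full`, venture `Summits/Ventures/Crystal3D`.  Planner rung `rung_integral_smooth`
(`HOME/cf-p1/route/lines/LayerChainV4Rungs.lean`, R7 [S/M]; input of stub (C) `PlateauBound`),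
VERBATIM signature: `∫ smooth x K L = N/√2` for `K, L > 0`.
Proof: Fubini for the continuous compactly supported integrand `η_L(z) · v(y − (z,0))` on
`ℝ³ × ℝ²`, translation invariance of Lebesgue measure, `∫ v = N · ∫ φ_K = N/√2` (R1,
`rung_integral_bump`, p507991) and `∫ η_L = 1` (R2, `rung_integral_eta`, p507748).
WHAT THIS IS NOT: anything about the crux; a calculus identity.
-/

noncomputable section

namespace Summit.Ventures.Crystal3D.Theorems

open MeasureTheory Set Function
open Summit.Ventures.Crystal3D.LayerChain (dot3)
open Summit.Ventures.Crystal3D.Cruxes.StackingLiminf.LayerChainV4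

/-- The bump has compact support. -/
theorem hasCompactSupport_bump {K : ℝ} (hK : 0 < K) : HasCompactSupport (bump K) := by
  refine HasCompactSupport.intro (isCompact_closedBall (0 : Fin 3 → ℝ) K) fun u hu => ?_
  rw [Metric.mem_closedBall, dist_zero_right, not_le] at hu
  obtain ⟨j, hj⟩ : ∃ j : Fin 3, K < |u j| := by
    by_contra h
    push Not at h
    have : ‖u‖ ≤ K := (pi_norm_le_iff_of_nonneg hK.le).2 fun j => by
      rw [Real.norm_eq_abs]; exact h j
    linarith
  exact bump_eq_zero_of_coord hK j hj.le

/-- Total mass of the mollified density: `∫ v = N/√2`. -/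
theorem integral_dens {N : ℕ} (x : Fin N → EuclideanSpace ℝ (Fin 3)) {K : ℝ} (hK : 0 < K) :
    ∫ y, dens x K y = (N : ℝ) / Real.sqrt 2 := by
  unfold dens
  have hint : ∀ i : Fin N, Integrable fun y : Fin 3 → ℝ => bump K (fun j => y j - x i j) := by
    intro i
    have h : (fun y : Fin 3 → ℝ => bump K (fun j => y j - x i j)) =
        fun y => bump K (y - fun j => x i j) := rfl
    rw [h]
    exact ((continuous_bump K).integrable_of_hasCompactSupport (hasCompactSupport_bump hK)).comp_sub_right _
  rw [integral_finsetSum _ fun i _ => hint i]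
  have hterm : ∀ i : Fin N, ∫ y : Fin 3 → ℝ, bump K (fun j => y j - x i j) = 1 / Real.sqrt 2 := by
    intro i
    have h : (fun y : Fin 3 → ℝ => bump K (fun j => y j - x i j)) =
        fun y => bump K (y - fun j => x i j) := rfl
    rw [h, integral_sub_right_eq_self (bump K), rung_integral_bump K hK]
  simp_rw [hterm]
  rw [Finset.sum_const, Finset.card_univ, Fintype.card_fin, nsmul_eq_mul]
  ring

/-- The integrand of `smooth` is jointly continuous. -/
theorem continuous_smooth_integrand {N : ℕ} (x : Fin N → EuclideanSpace ℝ (Fin 3)) (K L : ℝ) :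
    Continuous (uncurry fun (y : Fin 3 → ℝ) (z : ℝ × ℝ) =>
      eta L z * dens x K (fun j => y j - (![z.1, z.2, 0] : Fin 3 → ℝ) j)) := by
  refine ((continuous_eta L).comp continuous_snd).mul ((contDiff_dens x K).continuous.comp ?_)
  exact continuous_pi fun j => by fin_cases j <;> simp <;> fun_prop

/-- The integrand of `smooth` has compact support on `ℝ³ × ℝ²`. -/
theorem hasCompactSupport_smooth_integrand {N : ℕ} (x : Fin N → EuclideanSpace ℝ (Fin 3)) {K L : ℝ}
    (hK : 0 < K) (hL : 0 < L) :
    HasCompactSupport (uncurry fun (y : Fin 3 → ℝ) (z : ℝ × ℝ) =>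
      eta L z * dens x K (fun j => y j - (![z.1, z.2, 0] : Fin 3 → ℝ) j)) := by
  set R : ℝ := K + L + ∑ i : Fin N, ∑ l : Fin 3, |x i l| with hR
  refine HasCompactSupport.intro (isCompact_closedBall (0 : (Fin 3 → ℝ) × (ℝ × ℝ)) R)
    fun p hp => ?_
  rw [Metric.mem_closedBall, dist_zero_right, Prod.norm_def, max_le_iff, not_and_or] at hp
  simp only [uncurry]
  by_cases hz : L ≤ |p.2.1| ∨ L ≤ |p.2.2|
  · rw [eta_eq_zero_of_coord hL hz, zero_mul]
  · push Not at hz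
    rcases hp with hy | hz'
    · -- some coordinate of `y` is large
      rw [not_le] at hy
      obtain ⟨j, hj⟩ : ∃ j : Fin 3, R < |p.1 j| := by
        by_contra h
        push Not at h
        have : ‖p.1‖ ≤ R := (pi_norm_le_iff_of_nonneg (by positivity)).2 fun j => by
          rw [Real.norm_eq_abs]; exact h j
        linarith
      rw [dens_eq_zero_of_coord x hK _ j ?_, mul_zero]
      have hzj : |(![p.2.1, p.2.2, 0] : Fin 3 → ℝ) j| ≤ L := by
        fin_cases j <;> simp [hz.1.le, hz.2.le, hL.le]
      have := abs_sub_abs_le_abs_sub (p.1 j) ((![p.2.1, p.2.2, 0] : Fin 3 → ℝ) j)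
      linarith
    · -- `z` is large: contradiction with `hz`
      exfalso
      rw [not_le, Prod.norm_def, Real.norm_eq_abs, Real.norm_eq_abs, lt_max_iff] at hz'
      have hLR : L ≤ R := by rw [hR]; linarith [Finset.sum_nonneg (fun i (_ : i ∈ Finset.univ) =>
        Finset.sum_nonneg fun l (_ : l ∈ Finset.univ) => abs_nonneg (x i l))]
      rcases hz' with h | h <;> linarith [hz.1, hz.2]

/-- **R7 — the doubly mollified density has total mass exactly `N/√2`**. -/
theorem rung_integral_smooth (N : ℕ) (x : Fin N → EuclideanSpace ℝ (Fin 3)) (K L : ℝ) (hK : 0 < K)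
    (hL : 0 < L) : ∫ y, smooth x K L y = (N : ℝ) / Real.sqrt 2 := by
  have hF : Integrable (uncurry fun (y : Fin 3 → ℝ) (z : ℝ × ℝ) =>
      eta L z * dens x K (fun j => y j - (![z.1, z.2, 0] : Fin 3 → ℝ) j))
      ((volume : Measure (Fin 3 → ℝ)).prod (volume : Measure (ℝ × ℝ))) :=
    (continuous_smooth_integrand x K L).integrable_of_hasCompactSupport
      (hasCompactSupport_smooth_integrand x hK hL)
  unfold smooth
  rw [integral_integral_swap hF]
  have hinner : ∀ z : ℝ × ℝ, ∫ y : Fin 3 → ℝ, eta L z *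
      dens x K (fun j => y j - (![z.1, z.2, 0] : Fin 3 → ℝ) j) = eta L z * ((N : ℝ) / Real.sqrt 2) := by
    intro z
    rw [MeasureTheory.integral_const_mul]
    congr 1
    have h : (fun y : Fin 3 → ℝ => dens x K (fun j => y j - (![z.1, z.2, 0] : Fin 3 → ℝ) j)) =
        fun y => dens x K (y - ![z.1, z.2, 0]) := rfl
    rw [h, integral_sub_right_eq_self (dens x K), integral_dens x hK]
  simp_rw [hinner]
  rw [MeasureTheory.integral_mul_const, rung_integral_eta L hL, one_mul]

end Summit.Ventures.Crystal3D.Theorems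

end
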